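import Summits.QuantumFields.YangMills.Theorems.SmallFieldWideningWideningOfTiltAndMassSmallFieldCauchy

/-!
# Route SmallFieldWidening, crux `WindowCondCauchy` (stmt-QuantumFields-27825) — the COUPLING DOOR («via-tv» v2)

LINE g6-C «Cauchy door» (planner ym-idea-1 g6), answering the critic idea-crit-4 g4 (n2, 2026-08-28T12:39:40Z: «type the
one-step coupling as the first sub-stub»).  This file lands the PLUMBING of the coupling currency sorry-free, so that the line
«via-tv» has exactly ONE open obligation, `OneStepCoupling`:

* `windowUnitLaw F γ b₀ p₀ K` — the histGood-window-restricted K-th Gibbs law pushed to the unit lattice (unnormalised; the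
  measure under the route's `⨍`), `condUnitLaw` — its normalisation ν_K (the CONDITIONED unit law);
* `abs_average_sub_average_le_of_coupling` — pure measure theory: a coupling π of the normalisations of two finite measures
  with a measurable bad set B ⊇ {p.1 ≠ p.2} moves the `⨍` of any measurable |W| ≤ 1 by at most 2·π(B);
* `OneStepCoupling` — the typed ONE-STEP COUPLING obligation: for small γ, consecutive conditioned unit laws ν_K, ν_{K+1}
  admit couplings whose bad sets have summable mass (Σ t_K < ∞, π_K(B_K) ≤ t_K/2);
* `windowCondCauchy_of_oneStepCoupling : OneStepCoupling → WindowCondCauchy` (sorry-free, via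
  `WideningSmallFieldCauchy.smallFieldCauchy_of_summable_condIncrements`).

Nothing here is the RG content: `OneStepCoupling` is OPEN (it is the E3 core in coupling currency).  No summit is proved; R3 is
a record rung of LADDER-YM.
-/

set_option autoImplicit false
open MeasureTheory Filter Topology
open Literature.MathematicalPhysics.QuantumFieldTheory.Balaban1983to89
open Literature.MathematicalPhysics.QuantumFieldTheory.Balaban1983to89.Missing
open Literature.MathematicalPhysics.QuantumFieldTheory.Balaban1983to89.T3ContinuumYM3Torus
open Literature.MathematicalPhysics.QuantumFieldTheory.Balaban1983to89.T3UnitLawDensityEML (ℰp measurableE_ℰp)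
open Literature.MathematicalPhysics.QuantumFieldTheory.Balaban1983to89.T3UnitScaleTilt
open Summit.QuantumFields.YangMills.Theorems.WideningSmallFieldCauchy

namespace Summit.QuantumFields.YangMills.Theorems.WindowCondCauchyCoupling

/-! ## Pure measure theory: the increment bound of a coupling -/

/-- A coupling `π` of the normalisations of two measures `μ`, `μ'` with a measurable bad set `B ⊇ {p.1 ≠ p.2}` moves the
average of any measurable observable bounded by 1 by at most `2·π(B)`. -/
theorem abs_average_sub_average_le_of_coupling {X : Type*} [MeasurableSpace X]
    (μ μ' : Measure X) (π : Measure (X × X)) (B : Set (X × X)) [IsProbabilityMeasure π]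
    (h1 : π.map Prod.fst = (μ Set.univ)⁻¹ • μ) (h2 : π.map Prod.snd = (μ' Set.univ)⁻¹ • μ')
    (hB : MeasurableSet B) (hBd : ∀ p, p ∉ B → p.1 = p.2)
    (W : X → ℝ) (hWm : Measurable W) (hW : ∀ u, |W u| ≤ 1) :
    |(⨍ u, W u ∂μ') - ⨍ u, W u ∂μ| ≤ 2 * (π B).toReal := by
  have hav : ∀ (ν : Measure X), (⨍ u, W u ∂ν) = ∫ u, W u ∂((ν Set.univ)⁻¹ • ν) := by
    intro ν
    rw [average_eq, integral_smul_measure, ENNReal.toReal_inv]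
    simp only [measureReal_def]
  have hfst : (⨍ u, W u ∂μ) = ∫ p, W p.1 ∂π := by
    rw [hav μ, ← h1, integral_map measurable_fst.aemeasurable hWm.aestronglyMeasurable]
  have hsnd : (⨍ u, W u ∂μ') = ∫ p, W p.2 ∂π := by
    rw [hav μ', ← h2, integral_map measurable_snd.aemeasurable hWm.aestronglyMeasurable]
  rw [hfst, hsnd]
  have hi1 : Integrable (fun p : X × X => W p.1) π :=
    (integrable_const (1 : ℝ)).mono' (hWm.comp measurable_fst).aestronglyMeasurable
      (ae_of_all _ fun p => by simpa [Real.norm_eq_abs] using hW p.1)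
  have hi2 : Integrable (fun p : X × X => W p.2) π :=
    (integrable_const (1 : ℝ)).mono' (hWm.comp measurable_snd).aestronglyMeasurable
      (ae_of_all _ fun p => by simpa [Real.norm_eq_abs] using hW p.2)
  rw [← integral_sub hi2 hi1]
  have hpt : ∀ p : X × X, |W p.2 - W p.1| ≤ B.indicator (fun _ => (2 : ℝ)) p := by
    intro p
    by_cases hp : p ∈ B
    · rw [Set.indicator_of_mem hp]
      have h1' := hW p.1; have h2' := hW p.2
      rw [abs_le] at h1' h2' ⊢
      constructor <;> linarith [h1'.1, h1'.2, h2'.1, h2'.2]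
    · rw [Set.indicator_of_notMem hp, hBd p hp, sub_self, abs_zero]
  calc |∫ p, W p.2 - W p.1 ∂π| ≤ ∫ p, |W p.2 - W p.1| ∂π := abs_integral_le_integral_abs
    _ ≤ ∫ p, B.indicator (fun _ => (2 : ℝ)) p ∂π := by
        refine integral_mono (hi2.sub hi1).abs ((integrable_const (2 : ℝ)).indicator hB) hpt
    _ = 2 * (π B).toReal := by
        rw [integral_indicator_const _ hB, smul_eq_mul, mul_comm]
        simp only [measureReal_def]

/-! ## The window laws of the route and the typed one-step coupling -/

/-- The unit-lattice field space of a family. -/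
abbrev UnitSpace (F : T3Family) : Type := GaugeField (F.P 0) 0 (Matrix.specialUnitaryGroup (Fin 2) ℂ)

/-- The histGood-window-restricted K-th Gibbs law pushed forward to the unit lattice (unnormalised; the measure under the
route's `⨍` in `WindowCondCauchy` with `E := histGood`, `K₀ := 0`). -/
noncomputable def windowUnitLaw (F : T3Family) (γ b₀ p₀ : ℝ) (K : ℕ) : Measure (UnitSpace F) :=
  Measure.map (unitA F ℰp K) ((gibbsK F ℰp γ K).restrict (histGood F ℰp (θBal F.L γ b₀ p₀) K 0))

/-- The histGood-CONDITIONED K-th unit law ν_K (normalised `windowUnitLaw`). -/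
noncomputable def condUnitLaw (F : T3Family) (γ b₀ p₀ : ℝ) (K : ℕ) : Measure (UnitSpace F) :=
  (windowUnitLaw F γ b₀ p₀ K Set.univ)⁻¹ • windowUnitLaw F γ b₀ p₀ K

/-- ONE-STEP COUPLING (OPEN — the E3 core in coupling currency): for small γ, consecutive conditioned unit laws
ν_K, ν_{K+1} admit a coupling π_K with a measurable bad set B_K ⊇ {u ≠ u'} of mass ≤ t_K/2, Σ t_K < ∞. -/
def OneStepCoupling : Prop :=
  ∀ (L : ℕ) (b₀ p₀ : ℝ), 0 < b₀ → 2 < p₀ → ∃ γ₁ : ℝ, 0 < γ₁ ∧ ∀ (F : T3Family) (γ : ℝ), F.L = L → 0 < γ → γ ≤ γ₁ →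
    ∃ t : ℕ → ℝ, Summable t ∧ ∀ K : ℕ,
      ∃ (π : Measure (UnitSpace F × UnitSpace F)) (B : Set (UnitSpace F × UnitSpace F)),
        IsProbabilityMeasure π ∧ π.map Prod.fst = condUnitLaw F γ b₀ p₀ K ∧ π.map Prod.snd = condUnitLaw F γ b₀ p₀ (K + 1) ∧
        MeasurableSet B ∧ (∀ p, p ∉ B → p.1 = p.2) ∧ (π B).toReal ≤ t K / 2

/-- The coupling door: `OneStepCoupling` implies the summable-increment hypothesis of
`smallFieldCauchy_of_summable_condIncrements` (for every measurable unit observable bounded by 1). -/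
theorem summableCondIncrements_of_oneStepCoupling (h : OneStepCoupling) :
    ∀ (L : ℕ) (b₀ p₀ : ℝ), 0 < b₀ → 2 < p₀ → ∃ γ₁ : ℝ, 0 < γ₁ ∧ ∀ (F : T3Family) (γ : ℝ), F.L = L → 0 < γ →
      γ ≤ γ₁ → ∃ t : ℕ → ℝ, Summable t ∧
        ∀ (K : ℕ) (W : GaugeField (F.P 0) 0 (Matrix.specialUnitaryGroup (Fin 2) ℂ) → ℝ), Measurable W →
          (∀ u, |W u| ≤ 1) →
          |(⨍ u, W u ∂Measure.map (unitA F ℰp (K + 1))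
              ((gibbsK F ℰp γ (K + 1)).restrict (histGood F ℰp (θBal F.L γ b₀ p₀) (K + 1) 0))) -
            ⨍ u, W u ∂Measure.map (unitA F ℰp K)
              ((gibbsK F ℰp γ K).restrict (histGood F ℰp (θBal F.L γ b₀ p₀) K 0))| ≤ t K := by
  intro L b₀ p₀ hb₀ hp₀
  obtain ⟨γ₁, hγ₁, hF⟩ := h L b₀ p₀ hb₀ hp₀
  refine ⟨γ₁, hγ₁, fun F γ hFL hγ hγγ₁ => ?_⟩
  obtain ⟨t, ht, hK⟩ := hF F γ hFL hγ hγγ₁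
  refine ⟨t, ht, fun K W hWm hW => ?_⟩
  obtain ⟨π, B, hπ, h1, h2, hB, hBd, hBt⟩ := hK K
  have := abs_average_sub_average_le_of_coupling (windowUnitLaw F γ b₀ p₀ K) (windowUnitLaw F γ b₀ p₀ (K + 1)) π B
    h1 h2 hB hBd W hWm hW
  show |(⨍ u, W u ∂windowUnitLaw F γ b₀ p₀ (K + 1)) - ⨍ u, W u ∂windowUnitLaw F γ b₀ p₀ K| ≤ t K
  linarith

/-- The coupling door, by name: `OneStepCoupling` implies the crux `WindowCondCauchy` of route `SmallFieldWidening`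
(windows E := histGood, K₀ := 0, any floors). -/
theorem windowCondCauchy_of_oneStepCoupling (h : OneStepCoupling) :
    Summit.QuantumFields.YangMills.Theses.SmallFieldWidening.WindowCondCauchy := by
  intro L
  refine ⟨1, 3, fun b₀ p₀ _ _ hb₀ hp₀ => ?_⟩
  obtain ⟨γ₁, hγ₁, hF⟩ := summableCondIncrements_of_oneStepCoupling h L b₀ p₀ hb₀ hp₀
  refine ⟨γ₁, hγ₁, fun F γ hFL hγ hγγ₁ => ⟨0, fun K => histGood F ℰp (θBal F.L γ b₀ p₀) K 0,
    fun K => measurableSet_histGood F ℰp measurableE_ℰp _ K 0, fun K _ => subset_rfl, fun W hWm hW => ?_⟩⟩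
  obtain ⟨t, ht, h'⟩ := hF F γ hFL hγ hγγ₁
  simpa only [Nat.add_zero] using smallFieldCauchy_of_summable_condIncrements F ht h' hWm hW

/-- And hence rung R3 from the coupling door and r3 (by the Cauchy-door decision `ym3TorusSU2_of_windowCondCauchy`). -/
theorem ym3TorusSU2_of_oneStepCoupling (h : OneStepCoupling)
    (hM : Summit.QuantumFields.YangMills.Theses.SmallFieldWidening.LargeFieldMassRefinementTail) :
    Literature.MathematicalPhysics.QuantumFieldTheory.Balaban1983to89.T3YM3TorusStatement.YM3TorusSU2 :=
  ym3TorusSU2_of_windowCondCauchy (windowCondCauchy_of_oneStepCoupling h) hM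

end Summit.QuantumFields.YangMills.Theorems.WindowCondCauchyCoupling
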